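import Mathlib
import Literature.Probability.LatticeModels.ProdBernoulliIndependence
import Literature.Probability.Percolation.ConditionalPositiveAssociationProofs
import Literature.Probability.Percolation.PercolationProofs
import HarnessLib

/-!
# The spread switch: `stub_spreadSwitch`

This file proves `stub_spreadSwitch` (the "spread switch"), a consequence of the
Ahlswede–Daykin four functions theorem for product measures on a finite power set.

## Statement

Let `Q₀, …, Q_{L-1}` be pairwise disjoint events of bond configurations on `Fin n` such that the
meet `ω ∩ ω'` (intersection of the open-edge sets) of any two configurations taken from two
different `Q_i` lies in the zone `Z`, and suppose every `P(Q_i) ≤ m` (`0 ≤ m`) under a product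
measure `P = prodBernoulli w`.  Then `∑_i P(Q_i) ≤ m + 2 √P(Z)`.

## Proof

* (point masses) On the finite distributive lattice `Set (Sym2 (Fin n))` (`⊓ = ∩`, `⊔ = ∪`),
  `P(D) = ∑_ω p(ω) 1_D(ω)` with the product weights `p = BHK2006.weight`
  (`BHK2006.integral_prodBernoulli_eq_sum`), and `p(a) p(b) = p(a ∩ b) p(a ∪ b)`
  (`BHK2006.weight_inter_mul_union`).
* (four functions) For an index set `I` put `U = ⋃_{i ∈ I} Q_i`, `V = ⋃_{i ∉ I} Q_i`.  With
  `f₁ = p·1_U`, `f₂ = p·1_V`, `f₃ = p·1_Z`, `f₄ = p` the Ahlswede–Daykin hypothesis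
  `f₁(a) f₂(b) ≤ f₃(a ∩ b) f₄(a ∪ b)` holds pointwise (if `a ∈ Q_i`, `b ∈ Q_j` with `i ∈ I ∌ j`
  then `i ≠ j`, so `a ∩ b ∈ Z`; otherwise the left side vanishes), so Mathlib's
  `four_functions_theorem_univ` gives `P(U) P(V) ≤ P(Z) P(univ) = P(Z)`.
* (greedy split) For reals `q_i ∈ [0, m]` there is an index set `I` with
  `|∑_I q − ∑_{Iᶜ} q| ≤ m` (insert the indices one at a time into the currently lighter side).
* (arithmetic) With `x = ∑_I P(Q_i) = P(U)`, `y = ∑_{Iᶜ} P(Q_i) = P(V)` (disjointness),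
  `S = x + y`, `|x − y| ≤ m` and `x y ≤ P(Z) =: z`:
  `S² = (x − y)² + 4xy ≤ m² + 4z ≤ (m + 2√z)²`, whence `S ≤ m + 2√z`.

No percolation structure is used: the statement is purely about a product measure on a finite
power set.
-/

namespace Summit.CriticalPhenomena.PercolationContinuityZ3.Theorems

open scoped BigOperators Classical
open MeasureTheory Set
open Literature.Probability.LatticeModels (prodBernoulli)
open Literature.Probability.Percolation (BondConfig)
open Literature.Probability.Percolation.BHK2006 (weight weight_nonneg weight_inter_mul_union
  integral_prodBernoulli_eq_sum)
open Literature.Probability.Percolation.DecisionTree (ind ind_of_mem ind_of_not_mem ind_nonneg)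

/-- Greedy balanced split: reals `q_i ∈ [0, m]` indexed by a finset `s` split into two parts
`I ⊆ s` and `s ∖ I` whose sums differ by at most `m` (insert the elements one at a time into the
currently lighter side). [folklore] -/
private theorem nhlt_exists_balanced_subset {ι : Type*} [DecidableEq ι] (q : ι → ℝ) (m : ℝ)
    (hm : 0 ≤ m)
    (hq0 : ∀ i, 0 ≤ q i) (hqm : ∀ i, q i ≤ m) (s : Finset ι) :
    ∃ I ⊆ s, |∑ i ∈ I, q i - ∑ i ∈ s \ I, q i| ≤ m := by
  induction s using Finset.induction_on with
  | empty => exact ⟨∅, Finset.empty_subset _, by simp [hm]⟩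
  | insert a s ha ih =>
    obtain ⟨I, hIs, hI⟩ := ih
    have haI : a ∉ I := fun h => ha (hIs h)
    rw [abs_le] at hI
    by_cases hxy : ∑ i ∈ I, q i ≤ ∑ i ∈ s \ I, q i
    · refine ⟨insert a I, Finset.insert_subset_insert a hIs, ?_⟩
      rw [Finset.insert_sdiff_insert, Finset.sdiff_insert_of_notMem ha, Finset.sum_insert haI,
        abs_le]
      constructor <;> linarith [hq0 a, hqm a]
    · refine ⟨I, hIs.trans (Finset.subset_insert a s), ?_⟩
      have ha' : a ∉ s \ I := fun h => ha (Finset.mem_sdiff.1 h).1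
      rw [Finset.insert_sdiff_of_notMem s haI, Finset.sum_insert ha', abs_le]
      constructor <;> linarith [hq0 a, hqm a, not_le.1 hxy]

/-- Abstract four-functions step on a finite distributive lattice: if a nonnegative weight `p`
satisfies the FKG lattice condition `p a · p b ≤ p (a ⊓ b) · p (a ⊔ b)` and the meet of any
`a ∈ U` with any `b ∈ V` lies in `Z`, then `p(U) · p(V) ≤ p(Z) · p(univ)` for the weighted
masses `p(D) = ∑_a p a · 1_D a` (Ahlswede–Daykin with `f₁ = p 1_U`, `f₂ = p 1_V`, `f₃ = p 1_Z`,
`f₄ = p`; Mathlib's `four_functions_theorem_univ`). [folklore] -/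
private theorem nhlt_mass_mul_mass_le {α : Type*} [DistribLattice α] [Fintype α] (p : α → ℝ)
    (hp0 : ∀ a, 0 ≤ p a) (hp : ∀ a b, p a * p b ≤ p (a ⊓ b) * p (a ⊔ b)) (U V Z : Set α)
    (hUVZ : ∀ a ∈ U, ∀ b ∈ V, a ⊓ b ∈ Z) :
    (∑ a, p a * ind U a) * (∑ a, p a * ind V a) ≤ (∑ a, p a * ind Z a) * ∑ a, p a := by
  refine four_functions_theorem_univ (fun a => p a * ind U a) (fun a => p a * ind V a)
    (fun a => p a * ind Z a) p (fun a => mul_nonneg (hp0 a) (ind_nonneg _ _))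
    (fun a => mul_nonneg (hp0 a) (ind_nonneg _ _)) (fun a => mul_nonneg (hp0 a) (ind_nonneg _ _))
    hp0 fun a b => ?_
  by_cases ha : a ∈ U
  · by_cases hb : b ∈ V
    · rw [ind_of_mem ha, ind_of_mem hb, ind_of_mem (hUVZ a ha b hb), mul_one, mul_one, mul_one]
      exact hp a b
    · rw [ind_of_not_mem hb, mul_zero, mul_zero]
      exact mul_nonneg (mul_nonneg (hp0 _) (ind_nonneg _ _)) (hp0 _)
  · rw [ind_of_not_mem ha, mul_zero, zero_mul]
    exact mul_nonneg (mul_nonneg (hp0 _) (ind_nonneg _ _)) (hp0 _)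

/-- The `prodBernoulli w`-probability of an event on a finite configuration space `Set ι` is the
weighted sum of its indicator against the product weights. [folklore] -/
private theorem nhlt_real_eq_sum_weight_ind {ι : Type*} [Fintype ι] (w : ι → unitInterval)
    (D : Set (Set ι)) :
    (prodBernoulli w).real D = ∑ ω, weight (fun e => (w e : ℝ)) ω * ind D ω := by
  rw [← integral_indicator_one (MeasurableSet.of_discrete (s := D)),
    integral_prodBernoulli_eq_sum]
  refine Finset.sum_congr rfl fun ω _ => ?_
  by_cases hω : ω ∈ D
  · rw [Set.indicator_of_mem hω, ind_of_mem hω, Pi.one_apply]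
  · rw [Set.indicator_of_notMem hω, ind_of_not_mem hω, mul_zero]

/-- Four-functions step for the spread switch: for pairwise disjoint events `Q_i` of bond
configurations whose cross meets lie in `Z` and any index set `I`,
`(∑_{i ∈ I} P(Q_i)) · (∑_{i ∉ I} P(Q_i)) = P(⋃_I Q) · P(⋃_{Iᶜ} Q) ≤ P(Z)` under
`P = prodBernoulli w`. [folklore] -/
private theorem nhlt_split_mul_le {n L : ℕ} (w : Sym2 (Fin n) → unitInterval)
    (Q : Fin L → Set (BondConfig (Fin n))) (Z : Set (BondConfig (Fin n)))
    (hdisj : ∀ i j, i ≠ j → Disjoint (Q i) (Q j))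
    (hmeet : ∀ i j, i ≠ j → ∀ ω ∈ Q i, ∀ ω' ∈ Q j, ω ∩ ω' ∈ Z) (I : Finset (Fin L)) :
    (∑ i ∈ I, (prodBernoulli w).real (Q i)) * (∑ i ∈ Iᶜ, (prodBernoulli w).real (Q i)) ≤
      (prodBernoulli w).real Z := by
  have hU : (prodBernoulli w).real (⋃ i ∈ I, Q i) = ∑ i ∈ I, (prodBernoulli w).real (Q i) :=
    measureReal_biUnion_finset (fun i _ j _ hij => hdisj i j hij)
      (fun i _ => MeasurableSet.of_discrete)
  have hV : (prodBernoulli w).real (⋃ i ∈ Iᶜ, Q i) = ∑ i ∈ Iᶜ, (prodBernoulli w).real (Q i) :=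
    measureReal_biUnion_finset (fun i _ j _ hij => hdisj i j hij)
      (fun i _ => MeasurableSet.of_discrete)
  have hp0 : ∀ ω : Set (Sym2 (Fin n)), 0 ≤ weight (fun e => (w e : ℝ)) ω :=
    weight_nonneg (fun e => (w e).2.1) (fun e => (w e).2.2)
  have h1 : ∑ ω : Set (Sym2 (Fin n)), weight (fun e => (w e : ℝ)) ω = 1 := by
    have h := nhlt_real_eq_sum_weight_ind w (Set.univ : Set (BondConfig (Fin n)))
    rw [probReal_univ] at h
    rw [h]
    exact Finset.sum_congr rfl fun ω _ => by rw [ind_of_mem (Set.mem_univ ω), mul_one]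
  have hUVZ : ∀ a ∈ ⋃ i ∈ I, Q i, ∀ b ∈ ⋃ i ∈ Iᶜ, Q i, a ⊓ b ∈ Z := by
    intro a ha b hb
    obtain ⟨i, hi, hai⟩ := Set.mem_iUnion₂.1 ha
    obtain ⟨j, hj, hbj⟩ := Set.mem_iUnion₂.1 hb
    have hij : i ≠ j := fun h => (Finset.mem_compl.1 hj) (h ▸ hi)
    exact hmeet i j hij a hai b hbj
  have key := nhlt_mass_mul_mass_le (weight fun e => (w e : ℝ)) hp0
    (fun a b => (weight_inter_mul_union _ a b).le) (⋃ i ∈ I, Q i) (⋃ i ∈ Iᶜ, Q i) Z hUVZ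
  rw [← hU, ← hV, nhlt_real_eq_sum_weight_ind w (⋃ i ∈ I, Q i),
    nhlt_real_eq_sum_weight_ind w (⋃ i ∈ Iᶜ, Q i), nhlt_real_eq_sum_weight_ind w Z]
  calc _ ≤ _ := key
    _ = _ := by rw [h1, mul_one]

/-- The **spread switch**.
For pairwise disjoint events `Q₀, …, Q_{L-1}` of bond configurations on `Fin n` whose cross meets
`ω ∩ ω'` (`ω ∈ Q_i`, `ω' ∈ Q_j`, `i ≠ j`) lie in the zone `Z`, and every `P(Q_i) ≤ m` (`0 ≤ m`)
under `P = prodBernoulli w`: `∑_i P(Q_i) ≤ m + 2 √P(Z)`.  Proof: Ahlswede–Daykin four functions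
theorem on the lattice `Set (Sym2 (Fin n))` with the product point masses, plus a greedy balanced
split of the masses; see the module docstring. [folklore] -/
theorem stub_spreadSwitch :
    ∀ (n L : ℕ) (w : Sym2 (Fin n) → unitInterval) (Q : Fin L → Set (BondConfig (Fin n)))
      (Z : Set (BondConfig (Fin n))) (m : ℝ),
      0 ≤ m →
      (∀ i j, i ≠ j → Disjoint (Q i) (Q j)) →
      (∀ i j, i ≠ j → ∀ ω ∈ Q i, ∀ ω' ∈ Q j, ω ∩ ω' ∈ Z) →
      (∀ i, (prodBernoulli w).real (Q i) ≤ m) →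
      ∑ i, (prodBernoulli w).real (Q i) ≤ m + 2 * Real.sqrt ((prodBernoulli w).real Z) := by
  intro n L w Q Z m hm hdisj hmeet hQm
  -- greedy balanced split of the masses `P(Q_i) ∈ [0, m]`
  obtain ⟨I, -, hI⟩ := nhlt_exists_balanced_subset (fun i => (prodBernoulli w).real (Q i)) m hm
    (fun _ => measureReal_nonneg) hQm Finset.univ
  rw [← Finset.compl_eq_univ_sdiff, abs_le] at hI
  -- four functions: `P(⋃_I Q) P(⋃_{Iᶜ} Q) ≤ P(Z)`
  have hxy := nhlt_split_mul_le w Q Z hdisj hmeet I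
  rw [← Finset.sum_add_sum_compl I]
  set x : ℝ := ∑ i ∈ I, (prodBernoulli w).real (Q i) with hx
  set y : ℝ := ∑ i ∈ Iᶜ, (prodBernoulli w).real (Q i) with hy
  set z : ℝ := (prodBernoulli w).real Z with hz
  have hx0 : 0 ≤ x := Finset.sum_nonneg fun _ _ => measureReal_nonneg
  have hy0 : 0 ≤ y := Finset.sum_nonneg fun _ _ => measureReal_nonneg
  have hz0 : 0 ≤ z := measureReal_nonneg
  have hsq : Real.sqrt z ^ 2 = z := Real.sq_sqrt hz0
  have hs0 : 0 ≤ Real.sqrt z := Real.sqrt_nonneg z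
  -- `(x + y)² = (x - y)² + 4xy ≤ m² + 4z ≤ (m + 2√z)²`
  refine (pow_le_pow_iff_left₀ (add_nonneg hx0 hy0)
    (add_nonneg hm (mul_nonneg zero_le_two hs0)) two_ne_zero).1 ?_
  have hdiff : (x - y) ^ 2 ≤ m ^ 2 := by nlinarith [hI.1, hI.2]
  nlinarith [hdiff, hxy, mul_nonneg hm hs0, hsq]

end Summit.CriticalPhenomena.PercolationContinuityZ3.Theorems
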